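import Mathlib
import HarnessLib
import Summits.NavierStokesRegularity.NavierStokesRegularity.Theorems.TaylorModelRungThreeCertificateBoxFieldDStepM
import Summits.NavierStokesRegularity.NavierStokesRegularity.Theorems.TaylorModelRungThreeCertificateIntervalDOps

/-!
# Crux K1b-DR (stmt-NavierStokesRegularity-23954), line `taylor-model` — the FUSED (fma) variant of the linearised variational levels and of
# the (M) matrix: `applyLinF`, `wColLevelsF`, `stepMatrixMF` (same enclosures as `…BoxFieldDStepM`, ≈ ×1.9 fewer interpreter µs per entry)

PROPAGATE-V-SPEC-cert1 (rev. bcee1edc) recommends `p_v = 12` at `n = 88`: the matrix variational jets `W_k(H¹)` then cost ≈ 88 columns ×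
78 level pairs × ≈ 10³ operator entries ≈ 7·10⁶ entry updates per sub-step. MEASURED in the farm interpreter: an entry update by Moore's
`mulR` + `addR` ≈ 13 µs, by the sign-split fused `fmaR` (`…IntervalDOps`) ≈ 6.8 µs. This file re-runs part 7's array layer with the fused
primitive: `applyLinF` (fold step `acc ↦ fmaR prec B W[i] acc`), `wColStepF`/`wColLevelsF`, the predicate `IsLinSymEnclosureF`, the structural
`isVarJetEnclosureS_wColLevelsF`, `mem_varJet_of_wColLevelsF`; the cascade instance `isLinSymEnclosureF_linSym` (SAME tables `linSym` as
`…BoxFieldDLin`, via the step-parametric fold lemma `IntervalD.mem_sum_filter_foldl_step`), `mem_varJet_of_wColLevelsF_lin`, and the fused (M)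
matrix `stepMatrixMF` with `stepMatrixMF_spec` in the VDefs clause-(M) shape (identical statement to `stepMatrixM_spec`).

MODEL-lattice bookkeeping only (rung TL-M3); nothing here concerns the Navier–Stokes equations.
-/

-- the sub-problem namespace repeats the summit name by design (D-0017)
set_option linter.dupNamespace false

namespace Summit.NavierStokesRegularity.NavierStokesRegularity.Theorems.TaylorModelCert

open scoped BigOperators
open Literature.Analysis.FluidPDE.TaoCascade Literature.Analysis.FluidPDE.TaoCascade.TaylorChain
open Summit.NavierStokesRegularity.NavierStokesRegularity.Theorems.TaylorModelReadout (trunc trunc_apply qB varJet)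
open Summit.NavierStokesRegularity.NavierStokesRegularity.Theorems.TaylorModelV (basisSt)

namespace IntervalD

/-- **Fold enclosure with vanishing inactive terms, step-parametric**: any fold step that adds an enclosure of the active term to the
accumulator box encloses the full sum over the active sublist. [folklore] -/
theorem mem_sum_filter_foldl_step {τ : Type*} (F : τ → ℝ) (step : IntervalD → τ → IntervalD) (p : τ → Bool) :
    ∀ (l : List τ), (∀ t ∈ l, p t = false → F t = 0) →
      (∀ t ∈ l, p t = true → ∀ (acc : ℝ) (A : IntervalD), mem acc A → mem (acc + F t) (step A t)) →
      ∀ (acc : ℝ) (A : IntervalD), mem acc A → mem (acc + (l.map F).sum) ((l.filter p).foldl step A)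
  | [], _, _, acc, A, hA => by simpa using hA
  | t :: l, hz, hm, acc, A, hA => by
    rw [List.map_cons, List.sum_cons, List.filter_cons]
    by_cases hp : p t = true
    · rw [if_pos hp, List.foldl_cons, ← add_assoc]
      exact mem_sum_filter_foldl_step F step p l (fun s hs => hz s (List.mem_cons_of_mem t hs))
        (fun s hs => hm s (List.mem_cons_of_mem t hs)) _ _ (hm t List.mem_cons_self hp acc A hA)
    · rw [if_neg hp, hz t List.mem_cons_self (by simpa using hp), zero_add]
      exact mem_sum_filter_foldl_step F step p l (fun s hs => hz s (List.mem_cons_of_mem t hs))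
        (fun s hs => hm s (List.mem_cons_of_mem t hs)) _ _ hA

/-- Apply a linearised operator table to a column with the FUSED multiply-add: coordinate `c < n` is the fold `acc ↦ fmaR B W[i] acc`.
[folklore] -/
def applyLinF (n prec : ℕ) (op : Array (List (ℕ × IntervalD))) (W : Array IntervalD) : Array IntervalD :=
  Array.ofFn fun c : Fin n => (oget op c).foldl (fun acc e => fmaR prec e.2 (aget W e.1) acc) (ofInt 0)

/-- The per-column variational step through the shared tables, fused form. [folklore] -/
def wColStepF (n prec : ℕ) (ops : Array (Array (List (ℕ × IntervalD)))) (k : ℕ) (Us : Array (Array IntervalD)) : Array IntervalD :=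
  let prods : Array (Array IntervalD) := Array.ofFn fun m : Fin (k + 1) => applyLinF n prec (pget ops m) (lget Us (k - m))
  Array.ofFn fun c : Fin n => divNat prec (rangeSumR prec (fun m => aget (lget prods m) c) (k + 1)) (k + 1)

/-- **Variational interval jets of one direction column, fused form.** [folklore] -/
def wColLevelsF (n prec : ℕ) (ops : Array (Array (List (ℕ × IntervalD)))) (D : Array IntervalD) : ℕ → Array (Array IntervalD) :=
  buildLevels (wColStepF n prec ops) D

/-- Column-step outputs have size `n`. [folklore] -/
theorem size_wColStepF (n prec : ℕ) (ops : Array (Array (List (ℕ × IntervalD)))) (k : ℕ) (Us : Array (Array IntervalD)) :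
    (wColStepF n prec ops k Us).size = n := by
  simp only [wColStepF, Array.size_ofFn]

section SoundF

variable {V : Type*} (rd : V → ℕ → ℝ) (Q : V → V → V) (n prec : ℕ)

/-- The linearisation `mkOp A` encloses the symmetrised bilinear map through the FUSED application `applyLinF`. [folklore] -/
def IsLinSymEnclosureF (mkOp : Array IntervalD → Array (List (ℕ × IntervalD))) : Prop :=
  ∀ (A W : Array IntervalD) (u w : V), A.size = n → W.size = n →
    (∀ c < n, mem (rd u c) (aget A c)) → (∀ c < n, mem (rd w c) (aget W c)) →
      ∀ c < n, mem (rd (Q u w) c + rd (Q w u) c) (aget (applyLinF n prec (mkOp A) W) c)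

variable {rd Q n prec}

/-- **The fused per-column levels form a variational jet enclosure for the symmetrised twin** (structural). [folklore] -/
theorem isVarJetEnclosureS_wColLevelsF (mkOp : Array IntervalD → Array (List (ℕ × IntervalD))) {Ls : Array (Array IntervalD)} {K : ℕ}
    (hLs : ∀ m ≤ K, (lget Ls m).size = n) {D : Array IntervalD} (hD : D.size = n) :
    IsVarJetEnclosureS (fun A W (c : Fin n) => aget (applyLinF n prec (mkOp (Array.ofFn A)) (Array.ofFn W)) c) prec K (fnLevels n Ls)
      (fnLevels n (wColLevelsF n prec (opsOf mkOp Ls K) D K)) := by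
  intro k hk c x hx
  have hsz : ∀ {j : ℕ}, j ≤ K → (lget (buildLevels (wColStepF n prec (opsOf mkOp Ls K)) D K) j).size = n := fun hj =>
    size_lget_buildLevels _ D hD (size_wColStepF n prec _) hj
  have hlev : aget (lget (wColLevelsF n prec (opsOf mkOp Ls K) D K) (k + 1)) c =
      varJetStepS (fun A W (c : Fin n) => aget (applyLinF n prec (mkOp (Array.ofFn A)) (Array.ofFn W)) c) prec (fnLevels n Ls)
        (fnLevels n (wColLevelsF n prec (opsOf mkOp Ls K) D K)) k c := by
    simp only [varJetStepS]
    unfold wColLevelsF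
    rw [lget_buildLevels_of_le _ D (Nat.succ_le_of_lt hk), lget_buildLevels_succ]
    simp only [wColStepF]
    rw [aget_ofFn _ c.isLt]
    congr 1
    refine rangeSumR_congr prec (k + 1) fun m hm => ?_
    have hm' : m ≤ K := by omega
    have hkm : k - m ≤ K := by omega
    have e2 : lget (buildLevels (wColStepF n prec (opsOf mkOp Ls K)) D k) (k - m) =
        lget (buildLevels (wColStepF n prec (opsOf mkOp Ls K)) D K) (k - m) := by
      rw [lget_buildLevels_of_le _ D hkm, lget_buildLevels_of_le _ D (Nat.sub_le k m)]
    rw [lget_ofFn _ hm]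
    dsimp only
    rw [pget_opsOf mkOp Ls (by omega), e2, ofFn_fnLevels (hLs m hm'), ofFn_fnLevels (hsz hkm)]
  show mem x (aget (lget (wColLevelsF n prec (opsOf mkOp Ls K) D K) (k + 1)) c)
  rw [hlev]; exact hx

/-- **Variational jets of one direction column through the fused tables.** [folklore] -/
theorem mem_varJet_of_wColLevelsF {T : V → ℕ → V} {U : V → V → ℕ → V} (hT0 : ∀ x, ∀ c < n, rd (T x 0) c = rd x c)
    (hTs : ∀ x (k : ℕ), ∀ c < n, ((k : ℝ) + 1) * rd (T x (k + 1)) c =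
      ∑ i ∈ Finset.range (k + 1), rd (Q (T x i) (T x (k - i))) c)
    (hU0 : ∀ x v, ∀ c < n, rd (U x v 0) c = rd v c)
    (hUs : ∀ x v (k : ℕ), ∀ c < n, ((k : ℝ) + 1) * rd (U x v (k + 1)) c =
      ∑ i ∈ Finset.range (k + 1), (rd (Q (T x i) (U x v (k - i))) c + rd (Q (U x v (k - i)) (T x i)) c))
    {QBA : Array IntervalD → Array IntervalD → Array IntervalD} (hQBA : IsFieldEnclosureA rd Q n QBA)
    {mkOp : Array IntervalD → Array (List (ℕ × IntervalD))} (hOp : IsLinSymEnclosureF rd Q n prec mkOp)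
    (K : ℕ) {Y D : Array IntervalD} (hY : Y.size = n) (hD : D.size = n) {y v : V}
    (hy : ∀ c < n, mem (rd y c) (aget Y c)) (hv : ∀ c < n, mem (rd v c) (aget D c)) :
    ∀ k ≤ K, ∀ c < n, mem (rd (U y v k) c)
      (aget (lget (wColLevelsF n prec (opsOf mkOp (jetLevelsA n QBA prec Y K) K) D K) k) c) := by
  have hQS : IsSymFieldEnclosure (fun (x : V) (c : Fin n) => rd x c) Q
      (fun A W (c : Fin n) => aget (applyLinF n prec (mkOp (Array.ofFn A)) (Array.ofFn W)) c) := by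
    intro A W u w hu hw c
    refine hOp (Array.ofFn A) (Array.ofFn W) u w Array.size_ofFn Array.size_ofFn ?_ ?_ c c.isLt
    · intro c' hc'; rw [aget_ofFn A hc']; exact hu ⟨c', hc'⟩
    · intro c' hc'; rw [aget_ofFn W hc']; exact hw ⟨c', hc'⟩
  have hy' : ∀ c : Fin n, mem (rd y c) (fnLevels n (jetLevelsA n QBA prec Y K) 0 c) := fun c => by
    simp only [fnLevels]; rw [lget_jetLevelsA_zero]; exact hy c c.isLt
  have hv' : ∀ c : Fin n, mem (rd v c) (fnLevels n (wColLevelsF n prec (opsOf mkOp (jetLevelsA n QBA prec Y K) K) D K) 0 c) :=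
    fun c => by simp only [fnLevels]; unfold wColLevelsF; rw [lget_buildLevels_zero]; exact hv c c.isLt
  intro k hk c hc
  exact mem_varJet_of_isVarJetEnclosureS (rd := fun (x : V) (c : Fin n) => rd x c) (Q := Q) (T := T) (U := U)
    (fun x c => hT0 x c c.isLt) (fun x k c => hTs x k c c.isLt) (fun x v c => hU0 x v c c.isLt)
    (fun x v k c => hUs x v k c c.isLt) (isFieldEnclosure_fnField hQBA) hQS (isJetEnclosure_jetLevelsA QBA prec K hY)
    (isVarJetEnclosureS_wColLevelsF mkOp (fun m hm => size_lget_jetLevelsA n QBA prec hY hm) hD) hy' hv' k hk ⟨c, hc⟩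

end SoundF

end IntervalD

namespace CertTables

section Defs

variable {K : Type} [Field K] [LinearOrder K]

/-- **The fused (M) matrix of a sub-step** (same data as `stepMatrixM`, fused inner folds). [folklore] -/
def stepMatrixMF (T : CertTables K) (coefB : Fin 4 → Fin 4 → Fin 4 → ℕ → ℤ → IntervalD) (prec : ℕ) (Y : Array IntervalD) (pV : ℕ)
    (Hh : IntervalD) (S Winv : Array IntervalD) : Array (Array IntervalD) :=
  let mt := T.monosTable coefB
  let Ls := IntervalD.jetLevelsA T.n (T.qBboxMA coefB prec mt) prec Y pV
  let ops := IntervalD.opsOf (T.linSym coefB prec mt) Ls pV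
  let cols : Array (Array IntervalD) := Array.ofFn fun col : Fin T.n =>
    IntervalD.polyLevelsA T.n prec (IntervalD.wColLevelsF T.n prec ops (IntervalD.basisBoxA T.n col) pV) pV Hh
  IntervalD.stepMatA T.n prec cols S Winv

end Defs

section Sound

variable {K : Type} [Field K] {φ : K →+* ℝ} (T : CertTables K) {coefB : Fin 4 → Fin 4 → Fin 4 → ℕ → ℤ → IntervalD}

/-- **The linearised symmetric twin encloses `qB d u w + qB d w u` through the fused application.** [folklore] -/
theorem isLinSymEnclosureF_linSym (hco : T.CoefOK φ) (hcB : CoefBoxOK φ T coefB) (prec : ℕ) :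
    IntervalD.IsLinSymEnclosureF T.wv (qBf (T.toCertData φ)) T.n prec (T.linSym coefB prec (T.monosTable coefB)) := by
  intro A W u w _ _ hu hw c hc
  set d := T.toCertData φ with hd
  set i := T.wi c
  set k := T.wk c
  have hk : -T.Kb ≤ k ∧ k ≤ T.Ka := T.InW_wk hc
  have hKb : d.Kb = T.Kb := rfl
  have hKa : d.Ka = T.Ka := rfl
  have hu' : ∀ (a' : Fin 4) {k' : ℤ}, (-T.Kb ≤ k' ∧ k' ≤ T.Ka) → IntervalD.mem (u a' k') (IntervalD.aget A (T.idx a' k')) := by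
    intro a' k' hk'
    have h := hu (T.idx a' k') (T.idx_lt_n a' hk')
    rwa [T.wv_idx u a' hk'] at h
  have hw' : ∀ (a' : Fin 4) {k' : ℤ}, (-T.Kb ≤ k' ∧ k' ≤ T.Ka) → IntervalD.mem (w a' k') (IntervalD.aget W (T.idx a' k')) := by
    intro a' k' hk'
    have h := hw (T.idx a' k') (T.idx_lt_n a' hk')
    rwa [T.wv_idx w a' hk'] at h
  unfold IntervalD.applyLinF
  rw [IntervalD.aget_ofFn _ hc, T.oget_linSym prec _ A hc, T.tget_monosTable hc, List.foldl_append, List.foldl_map, List.foldl_map]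
  unfold activeMonos
  show IntervalD.mem (qB d u w i k + qB d w u i k) _
  unfold qB
  rw [hKb, hKa, if_pos hk, if_pos hk]
  simp only [sum_fin4_eq, sum_shiftSet_eq]
  rw [sum3_eq_tripleList, sum3_eq_tripleList]
  have key : ∀ t ∈ tripleList, ∀ (y z : Fin 4 → ℤ → ℝ),
      let a' : Fin 4 := ⟨t.1 % 4, Nat.mod_lt _ (by omega)⟩
      let b' : Fin 4 := ⟨t.2.1 % 4, Nat.mod_lt _ (by omega)⟩
      d.α a' b' i (shifts.getD t.2.2 (0, 0, 0)) * (1 + 1 : ℝ) ^ ((5 : ℝ) * (k - (shifts.getD t.2.2 (0, 0, 0)).2.2) / 2) *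
          (trunc d y a' (k - (shifts.getD t.2.2 (0, 0, 0)).2.2 + (shifts.getD t.2.2 (0, 0, 0)).1) *
            trunc d z b' (k - (shifts.getD t.2.2 (0, 0, 0)).2.2 + (shifts.getD t.2.2 (0, 0, 0)).2.1)) =
        φ (T.coefAt a' b' i t.2.2 k) *
          ((if -T.Kb ≤ fShell₁ t.2.2 k ∧ fShell₁ t.2.2 k ≤ T.Ka then y a' (fShell₁ t.2.2 k) else 0) *
            (if -T.Kb ≤ fShell₂ t.2.2 k ∧ fShell₂ t.2.2 k ≤ T.Ka then z b' (fShell₂ t.2.2 k) else 0)) := by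
    intro t ht y z
    obtain ⟨-, -, hμ⟩ := tripleList_lt _ ht
    dsimp only
    rw [hco _ _ i t.2.2 k hμ hk.1 hk.2, hd, toCertData_α, shifts_getD t.2.2 hμ, if_pos hμ, one_add_one_eq_two]
    rfl
  have hzero : ∀ t ∈ tripleList, T.isActive coefB i k t = false → ∀ (y z : Fin 4 → ℤ → ℝ),
      φ (T.coefAt ⟨t.1 % 4, Nat.mod_lt _ (by omega)⟩ ⟨t.2.1 % 4, Nat.mod_lt _ (by omega)⟩ i t.2.2 k) *
        ((if -T.Kb ≤ fShell₁ t.2.2 k ∧ fShell₁ t.2.2 k ≤ T.Ka then y ⟨t.1 % 4, Nat.mod_lt _ (by omega)⟩ (fShell₁ t.2.2 k) else 0) *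
          (if -T.Kb ≤ fShell₂ t.2.2 k ∧ fShell₂ t.2.2 k ≤ T.Ka then z ⟨t.2.1 % 4, Nat.mod_lt _ (by omega)⟩ (fShell₂ t.2.2 k) else 0)) = 0 := by
    intro t ht hin y z
    obtain ⟨-, -, hμ⟩ := tripleList_lt _ ht
    simp only [isActive, Bool.and_eq_false_iff, Bool.not_eq_false', decide_eq_false_iff_not, decide_eq_true_eq] at hin
    rcases hin with hwin | hz
    · rcases not_and_or.1 hwin with h1 | h2
      · rw [if_neg h1, zero_mul, mul_zero]
      · rw [if_neg h2, mul_zero, mul_zero]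
    · rw [IntervalD.eq_zero_of_mem_pointZero hz (hcB _ _ i t.2.2 k hμ hk.1 hk.2), zero_mul]
  have h1 := IntervalD.mem_sum_filter_foldl_step
    (fun t : ℕ × ℕ × ℕ => φ (T.coefAt ⟨t.1 % 4, Nat.mod_lt _ (by omega)⟩ ⟨t.2.1 % 4, Nat.mod_lt _ (by omega)⟩ i t.2.2 k) *
      ((if -T.Kb ≤ fShell₁ t.2.2 k ∧ fShell₁ t.2.2 k ≤ T.Ka then u ⟨t.1 % 4, Nat.mod_lt _ (by omega)⟩ (fShell₁ t.2.2 k) else 0) *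
        (if -T.Kb ≤ fShell₂ t.2.2 k ∧ fShell₂ t.2.2 k ≤ T.Ka then w ⟨t.2.1 % 4, Nat.mod_lt _ (by omega)⟩ (fShell₂ t.2.2 k) else 0)))
    (fun B t => IntervalD.fmaR prec (T.entryL coefB prec A i k t).2 (IntervalD.aget W (T.entryL coefB prec A i k t).1) B)
    (T.isActive coefB i k) tripleList (fun t ht hin => hzero t ht hin u w) (fun t ht hact acc B hB => by
      obtain ⟨-, -, hμ⟩ := tripleList_lt _ ht
      simp only [isActive, Bool.and_eq_true, decide_eq_true_eq] at hact
      obtain ⟨⟨hw1, hw2⟩, -⟩ := hact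
      dsimp only [entryL]
      rw [if_pos hw1, if_pos hw2, ← mul_assoc, add_comm]
      exact IntervalD.mem_fmaR prec (IntervalD.mem_mulR prec (hcB _ _ i t.2.2 k hμ hk.1 hk.2) (hu' _ hw1)) (hw' _ hw2) hB)
    0 _ IntervalD.mem_zero
  have h2 := IntervalD.mem_sum_filter_foldl_step
    (fun t : ℕ × ℕ × ℕ => φ (T.coefAt ⟨t.1 % 4, Nat.mod_lt _ (by omega)⟩ ⟨t.2.1 % 4, Nat.mod_lt _ (by omega)⟩ i t.2.2 k) *
      ((if -T.Kb ≤ fShell₁ t.2.2 k ∧ fShell₁ t.2.2 k ≤ T.Ka then w ⟨t.1 % 4, Nat.mod_lt _ (by omega)⟩ (fShell₁ t.2.2 k) else 0) *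
        (if -T.Kb ≤ fShell₂ t.2.2 k ∧ fShell₂ t.2.2 k ≤ T.Ka then u ⟨t.2.1 % 4, Nat.mod_lt _ (by omega)⟩ (fShell₂ t.2.2 k) else 0)))
    (fun B t => IntervalD.fmaR prec (T.entryR coefB prec A i k t).2 (IntervalD.aget W (T.entryR coefB prec A i k t).1) B)
    (T.isActive coefB i k) tripleList (fun t ht hin => hzero t ht hin w u) (fun t ht hact acc B hB => by
      obtain ⟨-, -, hμ⟩ := tripleList_lt _ ht
      simp only [isActive, Bool.and_eq_true, decide_eq_true_eq] at hact
      obtain ⟨⟨hw1, hw2⟩, -⟩ := hact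
      dsimp only [entryR]
      rw [if_pos hw1, if_pos hw2, mul_comm (w _ _), ← mul_assoc, add_comm]
      exact IntervalD.mem_fmaR prec (IntervalD.mem_mulR prec (hcB _ _ i t.2.2 k hμ hk.1 hk.2) (hu' _ hw2)) (hw' _ hw1) hB)
    _ _ h1
  rw [zero_add] at h2
  convert h2 using 2 <;>
    exact congrArg List.sum (List.map_congr_left fun t ht => key t ht _ _)

/-- **Variational jets of the cascade through the fused linearised tables.** [folklore] -/
theorem mem_varJet_of_wColLevelsF_lin (hco : T.CoefOK φ) (hcB : CoefBoxOK φ T coefB) (prec K : ℕ) {Y D : Array IntervalD}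
    (hY : Y.size = T.n) (hD : D.size = T.n) {y v : Fin 4 → ℤ → ℝ} (hy : ∀ c < T.n, IntervalD.mem (T.wv y c) (IntervalD.aget Y c))
    (hv : ∀ c < T.n, IntervalD.mem (T.wv v c) (IntervalD.aget D c)) :
    ∀ k ≤ K, ∀ c < T.n, IntervalD.mem (T.wv (varJet (T.toCertData φ).Qb y v k) c)
      (IntervalD.aget (IntervalD.lget (IntervalD.wColLevelsF T.n prec
        (IntervalD.opsOf (T.linSym coefB prec (T.monosTable coefB))
          (IntervalD.jetLevelsA T.n (T.qBboxMA coefB prec (T.monosTable coefB)) prec Y K) K) D K) k) c) := by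
  intro k hk c hc
  rw [← varJet_qBf]
  exact IntervalD.mem_varJet_of_wColLevelsF (T := TaylorModelReadout.taylorJet (qBf (T.toCertData φ)))
    (U := varJet (qBf (T.toCertData φ))) (fun x c _ => by rw [TaylorModelReadout.taylorJet_zero])
    (fun x k c _ => T.wv_taylorJet_qBf_succ x k c) (fun x v c _ => by rw [TaylorModelReadout.varJet_zero])
    (fun x v k c _ => T.wv_varJet_qBf_succ x v k c) (T.isFieldEnclosureA_qBboxMA hco hcB prec)
    (T.isLinSymEnclosureF_linSym hco hcB prec) K hY hD hy hv k hk c hc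

/-- **The fused (M) matrix satisfies clause (M) of `ChainVCore`** (same statement as `stepMatrixM_spec`). [folklore] -/
theorem stepMatrixMF_spec (hco : T.CoefOK φ) (hcB : CoefBoxOK φ T coefB) (prec pV : ℕ) {Y : Array IntervalD} (hY : Y.size = T.n)
    {z : Fin 4 → ℤ → ℝ} (hz : ∀ c < T.n, IntervalD.mem (T.wv z c) (IntervalD.aget Y c))
    {h : ℝ} {Hh : IntervalD} (hH : IntervalD.mem h Hh)
    {JU : Fin 4 → ℤ → ℝ} {S : Array IntervalD}
    (hS : ∀ i' k', -T.Kb ≤ k' → k' ≤ T.Ka → IntervalD.mem (JU i' k' * h ^ (pV + 1)) (IntervalD.aget S (T.idx i' k')))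
    {ω : ℤ → ℝ} {Winv : Array IntervalD} (hW : ∀ i k, -T.Kb ≤ k → k ≤ T.Ka → IntervalD.mem ((ω k)⁻¹) (IntervalD.aget Winv (T.idx i k)))
    (i : Fin 4) {k : ℤ} (hk1 : -T.Kb ≤ k) (hk2 : k ≤ T.Ka) (i' : Fin 4) {k' : ℤ} (hk1' : -T.Kb ≤ k') (hk2' : k' ≤ T.Ka) :
    (imget (T.stepMatrixMF coefB prec Y pV Hh S Winv) (T.idx i' k') (T.idx i k)).lo.toReal ≤
        (∑ n ∈ Finset.range (pV + 1), varJet (T.toCertData φ).Qb z (basisSt i k) n i' k' * h ^ n) - JU i' k' * (ω k)⁻¹ * h ^ (pV + 1) ∧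
      (∑ n ∈ Finset.range (pV + 1), varJet (T.toCertData φ).Qb z (basisSt i k) n i' k' * h ^ n) + JU i' k' * (ω k)⁻¹ * h ^ (pV + 1) ≤
        (imget (T.stepMatrixMF coefB prec Y pV Hh S Winv) (T.idx i' k') (T.idx i k)).hi.toReal := by
  have hr : T.idx i' k' < T.n := T.idx_lt_n i' ⟨hk1', hk2'⟩
  have hc : T.idx i k < T.n := T.idx_lt_n i ⟨hk1, hk2⟩
  have hcol : IntervalD.mem (∑ n ∈ Finset.range (pV + 1), varJet (T.toCertData φ).Qb z (basisSt i k) n i' k' * h ^ n)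
      (IntervalD.aget (IntervalD.lget (Array.ofFn fun col : Fin T.n => IntervalD.polyLevelsA T.n prec
        (IntervalD.wColLevelsF T.n prec (IntervalD.opsOf (T.linSym coefB prec (T.monosTable coefB))
          (IntervalD.jetLevelsA T.n (T.qBboxMA coefB prec (T.monosTable coefB)) prec Y pV) pV) (IntervalD.basisBoxA T.n col) pV) pV Hh)
        (T.idx i k)) (T.idx i' k')) := by
    rw [IntervalD.lget_ofFn _ hc]
    have hmv := T.mem_varJet_of_wColLevelsF_lin hco hcB prec pV hY (IntervalD.size_basisBoxA T.n (T.idx i k)) hz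
      (T.mem_basisSt_basisBoxA i ⟨hk1, hk2⟩)
    have hpoly := IntervalD.mem_polyLevelsA prec (a := fun n c => T.wv (varJet (T.toCertData φ).Qb z (basisSt i k) n) c)
      (fun n hn c hc' => hmv n hn c hc') hH (T.idx i' k') hr
    simpa only [T.wv_idx _ i' ⟨hk1', hk2'⟩] using hpoly
  have hM := IntervalD.stepMatA_spec prec hr hc hcol (hS i' k' hk1' hk2') (hW i k hk1 hk2)
  rw [mul_right_comm (JU i' k') (h ^ (pV + 1)) ((ω k)⁻¹)] at hM
  simpa only [stepMatrixMF] using hM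

end Sound

end CertTables

end Summit.NavierStokesRegularity.NavierStokesRegularity.Theorems.TaylorModelCert
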